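import Summits.AtomisticToContinuum.Crystallization.Theorems.ChartedZeroExcessLayeredLatticeLiouvilleZZZR

/-!
# ChartedZeroExcess · LayeredLatticeLiouville ZZZS (lens-2 g86 NODE 86) — «DeficitCurrency»: THE RESIDUAL ENERGETIC LEAF (OGᴸ) RE-CUT IN THE
# FRAME-INDIFFERENT DEFICIT: (OGᴸ)(g₀ := cE·D₀ − σ₀) ⟸ (RDᴸ) «off-tube cores have deficit ≥ D₀» [KINEMATIC, LJ-free] ∧ (DWᴸ) «the clamped energy is
# a cE-well in the deficit about every inner-tube critical tame filling» [ENERGETIC, a modulus modulo SITEWISE rotations]; W2″ DOOR OF RECORD PROVED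

Lineage `stmt-AtomisticToContinuum-26636` (route ChartedPlanarOrder, `ChartedZeroExcessLayered`), lens-2 «structural dichotomy (special vs generic)» g86.
BLOCKER FIRST: the residual energetic leaf of the W2 line of record after NODE 85 (critic row 1554: g85 VERIFIED; (XRᴸ) CLOSED; (OMᴸ) RESIDUAL-DECIDING;
(OGᴸ) `OffTubeGapP` ENERGETIC · WEAKER(QCᴸ⁺) · TWO-SIDED; plan A endorsed «price the icosahedral-12-star exclusion FIRST»).  TARGET of this node:
(OGᴸ) `OffTubeGapP ϑc ϑ ϑp r rΘ q rsh ρ rm σ ϑr Rs ε rI ℓ Rg sb dI dB sb₁ dI₁ dB₁ g₀ aHi Λ θ s` (tree ZZZRA), through it the W2′ door `mildCoolMoatCorePG_W2'_record`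
and the docket door `[MCMC](ϑc) = MildCoolMoatCorePG ϑc tameRadius (1/10) 8 4 12 16 1 2 (1/16) (1/50)`.

THE LENS APPLIED INSIDE (OGᴸ).  Plan A of NODE 85 named three ingredients for (OGᴸ) — a local energy well (CERT), discrete geometric rigidity
(Friesecke–James–Müller), clamped Korn — but typed none.  The obstruction to typing them in row 1540's currency `κ·Σ dist(xf i, y i)²` is recorded in the tree
(ZZZP/YM: the `1/10`-chart contains phonon-unstable homogeneous states, so no Hessian convexity over the chart; and a rigidly ROLLED grain is far from `y`
sitewise at no energy cost per unit `Σ dist²`).  The special/generic cut that dissolves both is by FRAME: measure the off-tube core `xf` against the filling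
`y` MODULO AN INDEPENDENT ROTATION AT EVERY SITE.  New object (★ `coreDeficit`): for reference sites `y₀ = lab ∘ xf`, filling `y`, core `xf` and a rotation
field `U : Fin n → (E3 ≃ₗᵢ[ℝ] E3)`,
  `D_Rd(xf; y, U) = Σ_i Σ_{j : dist(y₀ i, y₀ j) ≤ Rd} ‖(xf j − xf i) − U i (y j − y i)‖²`
— the sitewise-co-rotated bond misfit of `xf` against `y` on the tube's own pair set (`Rd = Rg` at the record).  SPECIAL class = deficit-free cores (every
`Rd`-star of `xf` a rotated copy of the corresponding star of `y`): by discrete rigidity + the `ε`-registered collar this class is EMPTY off the tube — that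
is piece (RDᴸ), a floor `D ≥ D₀`, LJ-FREE.  GENERIC class = cores with deficit `≥ D₀`: they pay energy `≥ cE·D₀ − σ₀` — that is piece (DWᴸ), an energy
inequality that is INVARIANT under sitewise rotations of the comparison and therefore immune to the rolled-grain / soft-rotation objection that sank the
position-space modulus.  Glue (PROVED, `offTubeGapP_of_deficit`): take the rotation field (DWᴸ) provides, apply (RDᴸ) to it, `g₀ = cE·D₀ − σ₀`.

PIECES (statements over tree notions only; tags per the cell doctrine).
* ★★★ (RDᴸ) `OffTubeDeficitFloorP … Rg sb dI dB sb₁ dI₁ dB₁ Rd D₀ …` — OFF THE OUTER TUBE THE DEFICIT AGAINST ANY INNER-TUBE CONFIGURATION IS ≥ D₀ FOR EVERY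
  ROTATION FIELD.  KINEMATIC (no energy, no criticality, no filling tameness: `y` is ANY member of the inner tube) · NEW · UNDECIDED · TRUE-type-expected with
  `D₀ ≈ 1.4·10³·(sb − sb₁)²` (desk: the cheapest off-tube core is ONE displaced atom, `D = 2·N_Rd·m²`, `N_Rd = 682` sites within `4.84`) · WEAKER-IN-KIND than
  (OGᴸ) (LJ-free; it cannot imply an energy statement — must-fail probe MF-1) · TWO-SIDED INSTRUMENTABLE «DeficitFloor-T» (per-site Kabsch on the OffTubeGap-T
  sample matrix; report `min D` over just-off-tube admissible cores; KILL(D₀) iff `min D < D₀`) · ATTACKABLE-L: discrete geometric rigidity on the `ϑp`-tame,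
  θ-good class (FJM 2002 Thm 3.1 in the lattice form of Schmidt 2009 / Theil 2006; cell fact `Literature.Analysis.PDE.FrieseckeJamesMuller2002_geometricRigidityLp`)
  + the `ε`-registered collar of `IsBondLabel` as boundary datum.  FIRST RUNG PROVED here (`coreDeficit_refl_bondClause`): with the IDENTITY rotation field a
  violated BOND clause alone forces `D ≥ (sb − sb₁)²`; the whole content of (RDᴸ) is (i) the infimum over ROTATION FIELDS (a single co-rotated pair term can
  vanish — rigidity is what forbids all `N_Rd` terms of a star to vanish together) and (ii) the interface/bulk clauses (reduced to the bond clause by the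
  collar chain `|xf i − y₀ i| ≤ ε + 3·sb`; not typed here).  RIGID-MOTION DEGENERACY (degenerate-witness pass, desk `numerics/rigid_budget.py`): the
  deficit is blind to ONE GLOBAL rigid motion `xf = R y + c`, and the inner tube lets `y` absorb a counter-rotation on the collar of angle `φ ≤ φ* :=
  min((sb₁ − 2ε)/Rg, dI₁/ρₐ)` (`ρₐ = 15.98 =` axis-distance of the interface-pinned shell at `ρ = 16`) — so with the budget `ω := sb₁ + Rg·φ*` the piece
  (RDᴸ)(D₀ > 0) is FALSE whenever `ω > sb` (EXPLICIT WITNESS at `sb₁ = dI₁ = 0.045` under the fat outer tube: `xf` = free zone rotated by `0.99·φ*`, blended to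
  the registered collar, centre atom displaced by `sb₁ − 0.0015`; `y := R⁻¹ xf` is in the inner tube, `xf` violates 121 outer bond clauses, deficit `= 0` for
  the constant field `R` — all clauses checked by enumeration on the 26 227-site core) and TRUE-type with `D₀ ≈ 2·N_Rg·(sb − ω)²` when `ω < sb`; the INNER
  TUBE MUST BE THIN: the fat door of record imposes `4·sb₁ ≤ sb`, `4·dI₁ ≤ dI` (then `ω = 0.0162 ≪ sb = 0.0498`, no witness, margin `0.035`, `D₀ ≈ 1.54`).
  Why it might fail in the thin regime: only a mis-set `D₀` — the qualitative `∃ D₀ > 0` is compactness + «deficit-free ⇒ one rigid motion ⇒ pinned by the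
  collar within the budget ⇒ in-tube», i.e. the rigidity lemma; BARRIER-free.
* ★★★ (DWᴸ) `DeficitWellP … Rg sb₁ dI₁ dB₁ Rd cE σ₀ …` — THE CLAMPED ENERGY IS A `cE`-WELL IN THE DEFICIT ABOUT EVERY INNER-TUBE CRITICAL TAME FILLING, UP TO
  `σ₀`: for every admissible core `xf` (in-tube or not) and every such `y` there is a rotation field `U` (det 1) with `E(y) + cE·D_Rd(xf; y, U) − σ₀ ≤ E(xf)`.
  ENERGETIC · NEW currency · UNDECIDED · TRUE-type-expected at `σ₀ = 0`, `cE ≲ 5·10⁻⁴` (desk: `E_exc/D` is minimised by smooth rotation/shear blobs,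
  `1.4·10⁻³` at width `4.5`, long-wave tetragonal-shear limit `5.5·10⁻⁴`; all sampled `E_exc > 0`) · WEAKER than (QCᴸ⁺) (PROVED `deficitWellP_of_labelTubeCoercivity`:
  (QCᴸ⁺)(κ) ⟹ (DWᴸ)(cE := κ/(4N), σ₀ := 0) with `U :=` identity and the packing count `N = (2(ρ+q)/(27/32) + 1)³`; the converse fails for rolled grains) ·
  does NOT imply (OGᴸ) alone (in-tube and off-tube cores are treated alike; no tube exclusion inside — must-fail probe MF-2) · TWO-SIDED INSTRUMENTABLE
  «WellModulus-T» (same sample matrix incl. IN-tube perturbations; report `min E_exc/D`; KILL(cE, σ₀) iff some admissible sample has `E_exc < cE·D − σ₀`) ·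
  ATTACKABLE-L: second-order expansion about the critical `y` + stability of the clamped lattice Hessian modulo sitewise rotations (E–Ming 2007, Ortner–Theil
  2013; Hudson–Ortner 2014 for defected reference states) — a STATEMENT ABOUT `y`'s BASIN in frame-indifferent coordinates, where the `1/10`-chart phonon
  objection does not apply (the chart enters only through `y`, an EQUILIBRIUM `s = 1/50` patch).  Why it might fail: a second critical filling in the inner tube
  below `y` (then `σ₀ ≥` their energy difference — the same caveat (OGᴸ)/(QCᴸ⁺) carry; (X1ᴸ) excludes it), or an admissible off-tube core whose misfit is
  energetically cheaper than `cE` per unit deficit beyond the harmonic regime (anharmonic softening at bond strains `→ ϑp = 1/10`; priced by WellModulus-T).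

CHEAPEST FALSIFIER PRICED FIRST (critic row 1554): the ICOSAHEDRAL 12-STAR.  Desk file `numerics/ico_exclusion.py` (+ `_stdout.txt`, sha256 in
`g86/numerics/SHA256SUMS`): (T) the radius-`4` star of the centre of ANY icosahedral 12-shell is `ϑ`-HOT for every `ϑ < 0.2297·a` (`a` = chart bond length;
bottleneck over rotations, shell radius and assignments against the cuboctahedron `0.22975` = `sin 13.28°`, the Mackay angle, attained Th-symmetrically with all
twelve residuals equal; against the anticuboctahedron `0.305`) — vs `ϑp = 1/10`: EXCLUDED with margin `×2.2` (vs `tameRadius`: `×4.5`); (G) its centre is NOT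
`θ`-good for any `θ < 0.2297·r` even with the AFFINE freedom of `IsTwoShellAffineGood` (best linear image of the 18-site fcc pattern: `0.22975·r`, hcp: `0.297·r`)
— vs `θ = 1/16`: EXCLUDED with margin `×3.3` at `r = 0.9`.  So tetrahedral frustration is OUTSIDE the admissible class of the docket by both filters
independently; the remaining off-tube adversaries are smooth near-rigid distortion fields anchored at the `ε`-collar (dislocation cores and terminating
stacking faults are `1/10`-hot as well: bond distortion `≈ b/2` across the glide plane at the core), for which (RDᴸ)/(DWᴸ) are the natural statements.
DESK TOY `numerics/deficit_toy.py` (+ `_stdout.txt`): LJ-fcc patch (`a_eq = 0.97416`, shells ≤ 7), 23 just-off-tube displacement families × {fat, marks}: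
`D₀_est = 1419·sb²` (`3.52` fat / `0.080` marks; single displaced atom), `cE_est ∈ [5.5·10⁻⁴, 1.4·10⁻³]`, hence `g₀_est = cE·D₀ ≈ 1.9·10⁻³` (fat) / `4.4·10⁻⁵`
(marks) at `σ₀ = 0`; no sample with `E_exc ≤ 0` (single-atom floor before the rigid-motion budget; with it `D₀ ≈ 1.54` fat, see (RDᴸ)).  PROPOSED CENSUS ROWS: «DeficitFloor-T» (two-sided, per-site Kabsch deficit on the OffTubeGap-T matrix) and
«WellModulus-T» (two-sided, `min E_exc/D` incl. in-tube perturbations and bond strains up to `1/10`).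

NET (0 sorry): `offTubeGapP_of_deficit` (RDᴸ) ∧ (DWᴸ) ⟹ (OGᴸ)(cE·D₀ − σ₀); `minInLabelTubeP_of_deficit` (QEᴸ⁺) ∧ (RDᴸ) ∧ (DWᴸ) ⟹ (OMᴸ);
`mildCoolMoatCorePG_W2''_record` / `_fat`: **`[MCMC](ϑc)` ⟸ (SC) ∧ (X1ᴸ) ∧ (X2ᴸ) ∧ (RDᴸ) ∧ (DWᴸ)** (`σ₀ < cE·D₀`; `_fat` with the thin inner tube
`sb₁, dI₁ ≤ sb/4` that the rigid-motion degeneracy of (RDᴸ) demands); weaker-than certificates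
`deficitWellP_of_labelTubeCoercivity`, `coreDeficit_refl_le`; first rung `coreDeficit_refl_bondClause`; vacuity guard `offTubeDeficitFloorP_of_nonpos`
(the content of (RDᴸ) is `D₀ > 0`); monotonicity in every dial.  WHY NOVEL (vs NODES 67 «TubeCut», 84/85 «LabelTube», lens-1 ChartedClusterCoercivity):
the cut is neither by distance to the filling nor by tube membership but by the FRAME-INDIFFERENT deficit, which splits (OGᴸ) into an LJ-free rigidity
theorem and a rotation-covariant energy inequality — the first typed consumer in this family of the cell's shared FJM lever, and the first currency in which
the rolled-grain and chart-phonon objections to a modulus both disappear.  WHY EACH PIECE IS STRICTLY WEAKER than the target: (RDᴸ) carries no energy and is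
implied by nothing energetic; (DWᴸ) is implied by (QCᴸ⁺) (PROVED) which (OGᴸ) does not imply back, and by itself excludes no core from anything.
Sources: tree ZZZP–ZZZR; G. Friesecke, R. D. James, S. Müller, Comm. Pure Appl. Math. 55 (2002) 1461, Thm 3.1; B. Schmidt, Multiscale Model. Simul. 8
(2009) 520; F. Theil, Comm. Math. Phys. 262 (2006) 209; W. E, P. Ming, Arch. Ration. Mech. Anal. 183 (2007) 241; C. Ortner, F. Theil, ARMA 207 (2013)
1025; T. Hudson, C. Ortner, ARMA 213 (2014) 887; A. L. Mackay, Acta Cryst. 15 (1962) 916 (the icosahedron–cuboctahedron angle); memo NODE-g86.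

0 sorry; imports = tree ZZZR only; axioms standard.
-/

noncomputable section

open scoped BigOperators Classical InnerProductSpace RealInnerProductSpace
open MeasureTheory Set Metric Filter Topology
open Literature.Geometry.DiscreteGeometry (IsTwoShellGoodSet)
open Literature.MathematicalPhysics.StatisticalMechanics (lennardJones card_le_of_separated_of_dist_le)

namespace Summit.AtomisticToContinuum.Crystallization.Theorems.ChartedZeroExcessLayeredLatticeLiouville

open Summit.AtomisticToContinuum.Crystallization.Theorems.ChartedPlanarOrderRigidityDoor (E3 IsClean)
open Summit.AtomisticToContinuum.Crystallization.Theorems.ChartedPlanarOrderDensityDichotomy (μS IsSep)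
open Summit.AtomisticToContinuum.Crystallization.Theorems.ChartedPlanarOrderCleanScaleP (IsCleanP IsDoorSetP)
open Summit.AtomisticToContinuum.Crystallization.Theorems.ChartedPlanarOrderMesoCut (LayeredHom EnvClose)
open Summit.AtomisticToContinuum.Crystallization.Theorems.ChartedPlanarOrderDoorLayeredOsc (IsTwoShellAffineGood)

/-! ### ZZZS-1  The frame-indifferent currency: the sitewise-co-rotated bond deficit of a core against a filling -/

section Deficit

variable {n : ℕ}

/-- ★ **`coreDeficit Rd y₀ y xf U`** — THE SITEWISE-CO-ROTATED BOND DEFICIT of the core `xf` against the filling `y` on the pair set of the reference sites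
`y₀` at range `Rd`: `Σ_i Σ_{j : dist(y₀ i, y₀ j) ≤ Rd} ‖(xf j − xf i) − U i (y j − y i)‖²`, `U i` an independent linear isometry at every site.  FRAME-INDIFFERENT
star by star (a core that is LOCALLY a rotated copy of `y` has deficit `0` whatever the rotations), hence blind to rigid rolling and soft local rotations and
sensitive exactly to strain, bending and tearing RELATIVE TO `y`.  The currency of (RDᴸ)/(DWᴸ). [this file, g86] -/
def coreDeficit (Rd : ℝ) (y₀ y xf : Fin n → E3) (U : Fin n → (E3 ≃ₗᵢ[ℝ] E3)) : ℝ :=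
  ∑ i, ∑ j, if dist (y₀ i) (y₀ j) ≤ Rd then ‖(xf j - xf i) - U i (y j - y i)‖ ^ 2 else 0

variable {Rd Rd' : ℝ} {y₀ y xf : Fin n → E3} {U : Fin n → (E3 ≃ₗᵢ[ℝ] E3)}

/-- the deficit is nonnegative. [formal bookkeeping] -/
theorem coreDeficit_nonneg : 0 ≤ coreDeficit Rd y₀ y xf U :=
  Finset.sum_nonneg fun i _ => Finset.sum_nonneg fun j _ => by split_ifs <;> positivity

/-- the deficit is monotone in the pair range. [formal bookkeeping] -/
theorem coreDeficit_mono (h : Rd ≤ Rd') : coreDeficit Rd y₀ y xf U ≤ coreDeficit Rd' y₀ y xf U :=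
  Finset.sum_le_sum fun i _ => Finset.sum_le_sum fun j _ => by
    by_cases h1 : dist (y₀ i) (y₀ j) ≤ Rd
    · rw [if_pos h1, if_pos (h1.trans h)]
    · rw [if_neg h1]; split_ifs <;> positivity

/-- a single pair term is below the deficit. [formal bookkeeping] -/
theorem term_le_coreDeficit (i j : Fin n) (hij : dist (y₀ i) (y₀ j) ≤ Rd) :
    ‖(xf j - xf i) - U i (y j - y i)‖ ^ 2 ≤ coreDeficit Rd y₀ y xf U := by
  unfold coreDeficit
  calc ‖(xf j - xf i) - U i (y j - y i)‖ ^ 2 = (if dist (y₀ i) (y₀ j) ≤ Rd then ‖(xf j - xf i) - U i (y j - y i)‖ ^ 2 else 0) := by rw [if_pos hij]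
    _ ≤ ∑ j', (if dist (y₀ i) (y₀ j') ≤ Rd then ‖(xf j' - xf i) - U i (y j' - y i)‖ ^ 2 else 0) :=
        Finset.single_le_sum (f := fun j' => if dist (y₀ i) (y₀ j') ≤ Rd then ‖(xf j' - xf i) - U i (y j' - y i)‖ ^ 2 else 0)
          (fun j' _ => by split_ifs <;> positivity) (Finset.mem_univ j)
    _ ≤ ∑ i', ∑ j', (if dist (y₀ i') (y₀ j') ≤ Rd then ‖(xf j' - xf i') - U i' (y j' - y i')‖ ^ 2 else 0) :=
        Finset.single_le_sum (f := fun i' => ∑ j', (if dist (y₀ i') (y₀ j') ≤ Rd then ‖(xf j' - xf i') - U i' (y j' - y i')‖ ^ 2 else 0))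
          (fun i' _ => Finset.sum_nonneg fun j' _ => by split_ifs <;> positivity) (Finset.mem_univ i)

/-- ★ **WEAKER-THAN CERTIFICATE (kinematic half)**: with the IDENTITY rotation field the deficit is dominated by the position-space currency of row 1540,
`D_Rd(xf; y, 1) ≤ 4·n·Σ dist(xf i, y i)²` (each pair term `≤ 2‖xf i − y i‖² + 2‖xf j − y j‖²`, then count). [this file, g86] -/
theorem coreDeficit_refl_le : coreDeficit Rd y₀ y xf (fun _ => LinearIsometryEquiv.refl ℝ E3) ≤ 4 * n * ∑ i, dist (xf i) (y i) ^ 2 := by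
  have hterm : ∀ i j, (if dist (y₀ i) (y₀ j) ≤ Rd then ‖(xf j - xf i) - (LinearIsometryEquiv.refl ℝ E3) (y j - y i)‖ ^ 2 else 0) ≤
      2 * dist (xf i) (y i) ^ 2 + 2 * dist (xf j) (y j) ^ 2 := by
    intro i j
    have h0 : 0 ≤ 2 * dist (xf i) (y i) ^ 2 + 2 * dist (xf j) (y j) ^ 2 := by positivity
    split_ifs
    · simp only [LinearIsometryEquiv.coe_refl, id_eq]
      have hre : (xf j - xf i) - (y j - y i) = (xf j - y j) - (xf i - y i) := by abel
      rw [hre, dist_eq_norm, dist_eq_norm]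
      have h1 : ‖(xf j - y j) - (xf i - y i)‖ ≤ ‖xf j - y j‖ + ‖xf i - y i‖ := norm_sub_le _ _
      have h2 : 0 ≤ ‖(xf j - y j) - (xf i - y i)‖ := norm_nonneg _
      nlinarith [sq_nonneg (‖xf j - y j‖ - ‖xf i - y i‖), norm_nonneg (xf j - y j), norm_nonneg (xf i - y i)]
    · exact h0
  calc coreDeficit Rd y₀ y xf (fun _ => LinearIsometryEquiv.refl ℝ E3)
      ≤ ∑ i, ∑ j, (2 * dist (xf i) (y i) ^ 2 + 2 * dist (xf j) (y j) ^ 2) :=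
        Finset.sum_le_sum fun i _ => Finset.sum_le_sum fun j _ => hterm i j
    _ = ∑ i, ((n : ℝ) * (2 * dist (xf i) (y i) ^ 2) + 2 * ∑ j, dist (xf j) (y j) ^ 2) := by
        refine Finset.sum_congr rfl fun i _ => ?_
        rw [Finset.sum_add_distrib, Finset.sum_const, Finset.card_univ, Fintype.card_fin, nsmul_eq_mul, Finset.mul_sum]
    _ = 4 * n * ∑ i, dist (xf i) (y i) ^ 2 := by
        rw [Finset.sum_add_distrib, Finset.sum_const, Finset.card_univ, Fintype.card_fin, nsmul_eq_mul, ← Finset.mul_sum, ← Finset.mul_sum]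
        ring

/-- ★ **FIRST RUNG OF (RDᴸ) (PROVED): with the IDENTITY rotation field, a violated BOND clause alone floors the deficit.**  If the pair `(i, j)` is a `Rd`-pair
of the reference, the core's bond deviates from the reference bond by `> sb`, and the filling's by `≤ sb₁ ≤ sb`, then `(sb − sb₁)² ≤ D_Rd(xf; y, 1)`.  The content
of (RDᴸ) beyond this rung is exactly the infimum over ROTATION FIELDS (rigidity) and the interface/bulk clauses (collar chain). [this file, g86] -/
theorem coreDeficit_refl_bondClause {sb sb₁ : ℝ} (hsb : sb₁ ≤ sb) (i j : Fin n) (hij : dist (y₀ i) (y₀ j) ≤ Rd)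
    (hoff : sb < dist (xf i - xf j) (y₀ i - y₀ j)) (hin : dist (y i - y j) (y₀ i - y₀ j) ≤ sb₁) :
    (sb - sb₁) ^ 2 ≤ coreDeficit Rd y₀ y xf (fun _ => LinearIsometryEquiv.refl ℝ E3) := by
  have key := term_le_coreDeficit (xf := xf) (y := y) (U := fun _ => LinearIsometryEquiv.refl ℝ E3) i j hij
  simp only [LinearIsometryEquiv.coe_refl, id_eq] at key
  have hre : (xf j - xf i) - (y j - y i) = -((xf i - xf j) - (y i - y j)) := by abel
  rw [hre, norm_neg] at key
  have htri : dist (xf i - xf j) (y₀ i - y₀ j) ≤ ‖(xf i - xf j) - (y i - y j)‖ + dist (y i - y j) (y₀ i - y₀ j) := by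
    rw [← dist_eq_norm]; exact dist_triangle _ _ _
  have hlow : sb - sb₁ ≤ ‖(xf i - xf j) - (y i - y j)‖ := by linarith
  have h0 : 0 ≤ sb - sb₁ := by linarith
  exact (pow_le_pow_left₀ h0 hlow 2).trans key

end Deficit

/-! ### ZZZS-2  The two pieces: (RDᴸ) the off-tube deficit floor (kinematic); (DWᴸ) the deficit well (energetic) -/

section Pieces

/-- ★★★ **(RDᴸ) «OffTubeDeficitFloorP … Rg sb dI dB sb₁ dI₁ dB₁ Rd D₀ …» — OFF THE OUTER TUBE, THE DEFICIT AGAINST EVERY INNER-TUBE CONFIGURATION IS AT LEAST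
`D₀`, FOR EVERY ROTATION FIELD.**  Under the binders of (OGᴸ) minus the door level (θ-good `aHi`-door set, equilibrium chart, container, `ϑp`-mild `rm`-core,
`ϑc`-cool moat, enumerated `ρ`-core `xf`, cool shadow crystal, bond label `lab`): if `xf ∉ bondTube (S ∖ core) Rg sb dI dB (lab ∘ xf)` then for every `y` in
the inner tube `bondTube … Rg sb₁ dI₁ dB₁ (lab ∘ xf)` (ANY member: no injectivity, criticality or tameness asked) and every field `U` of determinant-`1` linear
isometries, `D₀ ≤ coreDeficit Rd (lab ∘ xf) y xf U`.  KINEMATIC · LJ-FREE · NEW · UNDECIDED · TRUE-type (`D₀ ≈ 1.4·10³·(sb − sb₁)²` expected at `Rd = Rg`) ·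
TWO-SIDED INSTRUMENTABLE «DeficitFloor-T» · ATTACKABLE-L (discrete FJM rigidity on the tame θ-good class + registered collar) · first rung
`coreDeficit_refl_bondClause` · vacuous for `D₀ ≤ 0` (`offTubeDeficitFloorP_of_nonpos`).  Antitone in `D₀`, monotone in `Rd`.
TRUE-type ONLY FOR A THIN INNER TUBE (`sb > ω := sb₁ + Rg·min((sb₁ − 2ε)/Rg, dI₁/ρₐ)`, module docstring «rigid-motion degeneracy»: the deficit is blind
to one global rigid motion, which a fat inner tube lets `y` absorb on the collar); FALSE for every `D₀ > 0` at e.g. `sb₁ = dI₁ = 0.9·sb` (explicit witness,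
`numerics/rigid_budget.py`).  Why it might fail in the thin regime: only a mis-set `D₀`.  Sources: FJM 2002 Thm 3.1; Schmidt 2009; Theil 2006; desk
`deficit_toy.py`, `rigid_budget.py`. [this file, g86] -/
def OffTubeDeficitFloorP (ϑc ϑp r rΘ q rsh ρ rm σ ϑr Rs ε rI ℓ Rg sb dI dB sb₁ dI₁ dB₁ Rd D₀ aHi Λ θ s : ℝ) : Prop :=
  ∀ δ : ℝ, 0 < δ → ∀ a : ℝ, 0 < a →
    ∀ S : Set E3, IsDoorSetP aHi δ S → (∀ z : E3, Summable fun y : S => lennardJones (dist z (y : E3))) →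
      (∀ p ∈ S, IsTwoShellAffineGood θ S p) →
        ∀ (L : E3 ≃L[ℝ] E3) (w : ℤ → E3), IsEquilChart a s Λ L w →
          ∀ (x₀ : E3) (K : Set E3), K ⊆ S → (∀ k ∈ K, dist k x₀ ≤ q) →
            IsTameOn ϑp S (LayeredHom (L : E3 →L[ℝ] E3) w) (coreOf S K rm) →
              IsTameOn ϑc S (LayeredHom (L : E3 →L[ℝ] E3) w) (moatIn S K r (r + rsh)) →
                ∀ (n : ℕ) (xf : Fin n → E3), Function.Injective xf → Set.range xf = coreOf S K ρ →
                  ∀ (L' : E3 →L[ℝ] E3) (w' : ℤ → E3) (U : E3 ≃ₗᵢ[ℝ] E3) (t : E3),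
                    IsCoolShadowCrystal σ ϑr Rs ε r rI ℓ S K (LayeredHom (L : E3 →L[ℝ] E3) w) L' w' U t →
                      ∀ lab : E3 → E3, IsBondLabel ε rΘ ℓ S K (placedCrystal L' w' U t) lab →
                        xf ∉ bondTube (S \ coreOf S K ρ) Rg sb dI dB (fun i => lab (xf i)) →
                          ∀ y ∈ bondTube (S \ coreOf S K ρ) Rg sb₁ dI₁ dB₁ (fun i => lab (xf i)),
                            ∀ V : Fin n → (E3 ≃ₗᵢ[ℝ] E3), (∀ i, LinearMap.det ((V i).toLinearEquiv : E3 →ₗ[ℝ] E3) = 1) →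
                              D₀ ≤ coreDeficit Rd (fun i => lab (xf i)) y xf V

/-- ★★★ **(DWᴸ) «DeficitWellP … Rg sb₁ dI₁ dB₁ Rd cE σ₀ …» — THE CLAMPED ENERGY IS A `cE`-WELL IN THE DEFICIT ABOUT EVERY INNER-TUBE CRITICAL TAME FILLING,
UP TO `σ₀`.**  Under the binders of (QCᴸ⁺) (NO off-tube hypothesis: in-tube and off-tube cores alike): for every injective, exterior-avoiding,
clamped-critical, `ϑ`-tame filling `y` in the inner tube about `lab ∘ xf` there is a field `U` of determinant-`1` linear isometries with
`E(y) + cE·coreDeficit Rd (lab ∘ xf) y xf U − σ₀ ≤ E(xf)`.  ENERGETIC · ROTATION-COVARIANT (the comparison is modulo sitewise rotations, so rigid rolling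
and soft local rotations of `xf` relative to `y` are not charged) · NEW currency · UNDECIDED · TRUE-type at `σ₀ = 0`, `cE ≲ 5·10⁻⁴` · WEAKER than (QCᴸ⁺)
(`deficitWellP_of_labelTubeCoercivity`) · TWO-SIDED INSTRUMENTABLE «WellModulus-T» · ATTACKABLE-L (second-order expansion about the critical `y`; stability
of the clamped lattice Hessian modulo sitewise rotations: E–Ming 2007, Ortner–Theil 2013, Hudson–Ortner 2014).  Antitone in `cE` (deficit `≥ 0`), monotone
in `σ₀`, antitone in `Rd`; `σ₀ ≥ 0` intended (`σ₀ < 0` is false-type: take `xf := y`).  Why it might fail: a second, lower critical filling in the inner tube (`σ₀` must then absorb the difference; (X1ᴸ) excludes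
it), or anharmonic softening beyond the harmonic regime at bond strains `→ ϑp`.  Sources: module docstring; desk `deficit_toy.py`. [this file, g86] -/
def DeficitWellP (ϑc ϑ ϑp r rΘ q rsh ρ rm σ ϑr Rs ε rI ℓ Rg sb₁ dI₁ dB₁ Rd cE σ₀ aHi Λ θ s : ℝ) : Prop :=
  ∀ δ : ℝ, 0 < δ → ∀ a : ℝ, 0 < a →
    ∀ S : Set E3, IsDoorSetP aHi δ S → (∀ z : E3, Summable fun y : S => lennardJones (dist z (y : E3))) →
      (∀ p ∈ S, IsTwoShellAffineGood θ S p) →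
        ∀ (L : E3 ≃L[ℝ] E3) (w : ℤ → E3), IsEquilChart a s Λ L w →
          ∀ (x₀ : E3) (K : Set E3), K ⊆ S → (∀ k ∈ K, dist k x₀ ≤ q) →
            IsTameOn ϑp S (LayeredHom (L : E3 →L[ℝ] E3) w) (coreOf S K rm) →
              IsTameOn ϑc S (LayeredHom (L : E3 →L[ℝ] E3) w) (moatIn S K r (r + rsh)) →
                ∀ (n : ℕ) (xf : Fin n → E3), Function.Injective xf → Set.range xf = coreOf S K ρ →
                  ∀ (L' : E3 →L[ℝ] E3) (w' : ℤ → E3) (U : E3 ≃ₗᵢ[ℝ] E3) (t : E3),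
                    IsCoolShadowCrystal σ ϑr Rs ε r rI ℓ S K (LayeredHom (L : E3 →L[ℝ] E3) w) L' w' U t →
                      ∀ lab : E3 → E3, IsBondLabel ε rΘ ℓ S K (placedCrystal L' w' U t) lab →
                        ∀ y ∈ bondTube (S \ coreOf S K ρ) Rg sb₁ dI₁ dB₁ (fun i => lab (xf i)),
                          Function.Injective y → Disjoint (Set.range y) (S \ coreOf S K ρ) →
                            HasFDerivAt (fun z : Fin n → E3 => clampedEnergy (S \ coreOf S K ρ) z) (0 : (Fin n → E3) →L[ℝ] ℝ) y →
                              (∀ i, IsTameStar ϑ ((S \ coreOf S K ρ) ∪ Set.range y) (LayeredHom (L : E3 →L[ℝ] E3) w) (y i)) →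
                                ∃ V : Fin n → (E3 ≃ₗᵢ[ℝ] E3), (∀ i, LinearMap.det ((V i).toLinearEquiv : E3 →ₗ[ℝ] E3) = 1) ∧
                                  clampedEnergy (S \ coreOf S K ρ) y + cE * coreDeficit Rd (fun i => lab (xf i)) y xf V - σ₀ ≤
                                    clampedEnergy (S \ coreOf S K ρ) xf

/-- (RDᴸ) is antitone in the floor and monotone in the pair range. [formal bookkeeping] -/
theorem OffTubeDeficitFloorP.of_le {ϑc ϑp r rΘ q rsh ρ rm σ ϑr Rs ε rI ℓ Rg sb dI dB sb₁ dI₁ dB₁ Rd Rd' D₀ D₀' aHi Λ θ s : ℝ} (hD : D₀' ≤ D₀)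
    (hRd : Rd ≤ Rd') (h : OffTubeDeficitFloorP ϑc ϑp r rΘ q rsh ρ rm σ ϑr Rs ε rI ℓ Rg sb dI dB sb₁ dI₁ dB₁ Rd D₀ aHi Λ θ s) :
    OffTubeDeficitFloorP ϑc ϑp r rΘ q rsh ρ rm σ ϑr Rs ε rI ℓ Rg sb dI dB sb₁ dI₁ dB₁ Rd' D₀' aHi Λ θ s :=
  fun δ hδ a ha S hS hsum hgood L w hLw x₀ K hKS hKq hmild hcool n xf hxf hrange L' w' U t hC lab hlab hoff y hyT V hV =>
    (hD.trans (h δ hδ a ha S hS hsum hgood L w hLw x₀ K hKS hKq hmild hcool n xf hxf hrange L' w' U t hC lab hlab hoff y hyT V hV)).trans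
      (coreDeficit_mono hRd)

/-- (RDᴸ) is monotone in the OUTER radii (fewer off-tube cores) and antitone in the INNER radii (fewer fillings). [formal bookkeeping] -/
theorem OffTubeDeficitFloorP.mono_radii {ϑc ϑp r rΘ q rsh ρ rm σ ϑr Rs ε rI ℓ Rg sb dI dB sb' dI' dB' sb₁ dI₁ dB₁ sb₁' dI₁' dB₁' Rd D₀ aHi Λ θ s : ℝ}
    (hsb : sb ≤ sb') (hdI : dI ≤ dI') (hdB : dB ≤ dB') (hsb₁ : sb₁' ≤ sb₁) (hdI₁ : dI₁' ≤ dI₁) (hdB₁ : dB₁' ≤ dB₁)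
    (h : OffTubeDeficitFloorP ϑc ϑp r rΘ q rsh ρ rm σ ϑr Rs ε rI ℓ Rg sb dI dB sb₁ dI₁ dB₁ Rd D₀ aHi Λ θ s) :
    OffTubeDeficitFloorP ϑc ϑp r rΘ q rsh ρ rm σ ϑr Rs ε rI ℓ Rg sb' dI' dB' sb₁' dI₁' dB₁' Rd D₀ aHi Λ θ s :=
  fun δ hδ a ha S hS hsum hgood L w hLw x₀ K hKS hKq hmild hcool n xf hxf hrange L' w' U t hC lab hlab hoff y hyT V hV =>
    h δ hδ a ha S hS hsum hgood L w hLw x₀ K hKS hKq hmild hcool n xf hxf hrange L' w' U t hC lab hlab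
      (fun hin => hoff (bondTube_mono hsb hdI hdB hin)) y (bondTube_mono hsb₁ hdI₁ hdB₁ hyT) V hV

/-- VACUITY GUARD: (RDᴸ) with a nonpositive floor is free — the content is `D₀ > 0`. [formal bookkeeping] -/
theorem offTubeDeficitFloorP_of_nonpos {ϑc ϑp r rΘ q rsh ρ rm σ ϑr Rs ε rI ℓ Rg sb dI dB sb₁ dI₁ dB₁ Rd D₀ aHi Λ θ s : ℝ} (hD : D₀ ≤ 0) :
    OffTubeDeficitFloorP ϑc ϑp r rΘ q rsh ρ rm σ ϑr Rs ε rI ℓ Rg sb dI dB sb₁ dI₁ dB₁ Rd D₀ aHi Λ θ s :=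
  fun _ _ _ _ _ _ _ _ _ _ _ _ _ _ _ _ _ _ _ _ _ _ _ _ _ _ _ _ _ _ _ _ _ => hD.trans coreDeficit_nonneg

/-- (DWᴸ) is antitone in the modulus, monotone in the slack, antitone in the pair range. [formal bookkeeping] -/
theorem DeficitWellP.of_le {ϑc ϑ ϑp r rΘ q rsh ρ rm σ ϑr Rs ε rI ℓ Rg sb₁ dI₁ dB₁ Rd Rd' cE cE' σ₀ σ₀' aHi Λ θ s : ℝ} (hcE₀ : 0 ≤ cE') (hcE : cE' ≤ cE)
    (hσ : σ₀ ≤ σ₀') (hRd : Rd' ≤ Rd) (h : DeficitWellP ϑc ϑ ϑp r rΘ q rsh ρ rm σ ϑr Rs ε rI ℓ Rg sb₁ dI₁ dB₁ Rd cE σ₀ aHi Λ θ s) :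
    DeficitWellP ϑc ϑ ϑp r rΘ q rsh ρ rm σ ϑr Rs ε rI ℓ Rg sb₁ dI₁ dB₁ Rd' cE' σ₀' aHi Λ θ s := by
  intro δ hδ a ha S hS hsum hgood L w hLw x₀ K hKS hKq hmild hcool n xf hxf hrange L' w' U t hC lab hlab y hyT hyinj hydisj hcrit htame
  obtain ⟨V, hV, hE⟩ := h δ hδ a ha S hS hsum hgood L w hLw x₀ K hKS hKq hmild hcool n xf hxf hrange L' w' U t hC lab hlab y hyT hyinj hydisj hcrit htame
  refine ⟨V, hV, ?_⟩
  have h1 : coreDeficit Rd' (fun i => lab (xf i)) y xf V ≤ coreDeficit Rd (fun i => lab (xf i)) y xf V := coreDeficit_mono hRd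
  have h2 : 0 ≤ coreDeficit Rd' (fun i => lab (xf i)) y xf V := coreDeficit_nonneg
  nlinarith [mul_le_mul_of_nonneg_left h1 hcE₀, mul_le_mul_of_nonneg_right hcE (h2.trans h1)]

end Pieces

/-! ### ZZZS-3  The glue (RDᴸ) ∧ (DWᴸ) ⟹ (OGᴸ); the weaker-than certificate (QCᴸ⁺) ⟹ (DWᴸ); the doors of record -/

section Glue

/-- ★★★ **THE GLUE (PROVED): (RDᴸ)(Rd, D₀) ∧ (DWᴸ)(Rd, cE ≥ 0, σ₀) ⟹ (OGᴸ)(g₀ := cE·D₀ − σ₀).**  Take the rotation field the well provides at the critical tame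
inner-tube filling `y`; off the outer tube the floor bounds the deficit in that field from below. [this file, g86] -/
theorem offTubeGapP_of_deficit {ϑc ϑ ϑp r rΘ q rsh ρ rm σ ϑr Rs ε rI ℓ Rg sb dI dB sb₁ dI₁ dB₁ Rd D₀ cE σ₀ aHi Λ θ s : ℝ} (hcE : 0 ≤ cE)
    (hRD : OffTubeDeficitFloorP ϑc ϑp r rΘ q rsh ρ rm σ ϑr Rs ε rI ℓ Rg sb dI dB sb₁ dI₁ dB₁ Rd D₀ aHi Λ θ s)
    (hDW : DeficitWellP ϑc ϑ ϑp r rΘ q rsh ρ rm σ ϑr Rs ε rI ℓ Rg sb₁ dI₁ dB₁ Rd cE σ₀ aHi Λ θ s) :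
    OffTubeGapP ϑc ϑ ϑp r rΘ q rsh ρ rm σ ϑr Rs ε rI ℓ Rg sb dI dB sb₁ dI₁ dB₁ (cE * D₀ - σ₀) aHi Λ θ s := by
  intro δ hδ a ha S hS hsum hgood L w hLw x₀ K hKS hKq hmild hcool n xf hxf hrange L' w' U t hC lab hlab hoff y hyT hyinj hydisj hcrit htame
  obtain ⟨V, hV, hE⟩ := hDW δ hδ a ha S hS hsum hgood L w hLw x₀ K hKS hKq hmild hcool n xf hxf hrange L' w' U t hC lab hlab y hyT hyinj hydisj hcrit htame
  have hD := hRD δ hδ a ha S hS hsum hgood L w hLw x₀ K hKS hKq hmild hcool n xf hxf hrange L' w' U t hC lab hlab hoff y hyT V hV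
  nlinarith [mul_le_mul_of_nonneg_left hD hcE]

/-- ★★ **WEAKER-THAN CERTIFICATE (PROVED): (QCᴸ⁺)(κ ≥ 0) ⟹ (DWᴸ)(Rd, cE := κ/(4·N), σ₀ := 0)** at `aHi = 1`, `0 ≤ ρ + q`, with the packing count
`N = (2(ρ + q)/(27/32) + 1)³ ≥ n` of the core (`card_core_le`; door sets are `27/32`-separated): take the IDENTITY rotation field and `coreDeficit_refl_le`.
So (DWᴸ) is implied by row 1540's modulus; the converse fails (a rigidly rolled grain has large `Σ dist²` and small deficit). [this file, g86] -/
theorem deficitWellP_of_labelTubeCoercivity {ϑc ϑ ϑp r rΘ q rsh ρ rm σ ϑr Rs ε rI ℓ Rg sb₁ dI₁ dB₁ Rd κ Λ θ s : ℝ} (hκ : 0 ≤ κ) (hρq : 0 ≤ ρ + q)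
    (h : LabelTubeCoercivityP ϑc ϑ ϑp r rΘ q rsh ρ rm σ ϑr Rs ε rI ℓ Rg sb₁ dI₁ dB₁ κ 1 Λ θ s) :
    DeficitWellP ϑc ϑ ϑp r rΘ q rsh ρ rm σ ϑr Rs ε rI ℓ Rg sb₁ dI₁ dB₁ Rd (κ / (4 * (2 * (ρ + q) / (27 / 32) + 1) ^ 3)) 0 1 Λ θ s := by
  intro δ hδ a ha S hS hsum hgood L w hLw x₀ K hKS hKq hmild hcool n xf hxf hrange L' w' U t hC lab hlab y hyT hyinj hydisj hcrit htame
  have key := h δ hδ a ha S hS hsum hgood L w hLw x₀ K hKS hKq hmild hcool n xf hxf hrange L' w' U t hC lab hlab y hyT hyinj hydisj hcrit htame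
  refine ⟨fun _ => LinearIsometryEquiv.refl ℝ E3, fun _ => det_refl_E3_eq_one, ?_⟩
  set N : ℝ := (2 * (ρ + q) / (27 / 32) + 1) ^ 3 with hN
  have hNpos : 0 < N := by have h1 : 0 < 2 * (ρ + q) / (27 / 32) + 1 := by positivity
                           positivity
  have hn : (n : ℝ) ≤ N := card_core_le (by norm_num : (0 : ℝ) < 27 / 32) (isSep_of_isDoorSetP le_rfl hS) hKq hρq hxf hrange
  have hsum0 : 0 ≤ ∑ i, dist (xf i) (y i) ^ 2 := Finset.sum_nonneg fun i _ => by positivity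
  have hD := coreDeficit_refl_le (Rd := Rd) (y₀ := fun i => lab (xf i)) (y := y) (xf := xf)
  have h1 : κ / (4 * N) * coreDeficit Rd (fun i => lab (xf i)) y xf (fun _ => LinearIsometryEquiv.refl ℝ E3) ≤ κ * ∑ i, dist (xf i) (y i) ^ 2 :=
    calc κ / (4 * N) * coreDeficit Rd (fun i => lab (xf i)) y xf (fun _ => LinearIsometryEquiv.refl ℝ E3)
        ≤ κ / (4 * N) * (4 * n * ∑ i, dist (xf i) (y i) ^ 2) := mul_le_mul_of_nonneg_left hD (by positivity)
      _ ≤ κ / (4 * N) * (4 * N * ∑ i, dist (xf i) (y i) ^ 2) := by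
          apply mul_le_mul_of_nonneg_left _ (by positivity)
          exact mul_le_mul_of_nonneg_right (by linarith) hsum0
      _ = κ * ∑ i, dist (xf i) (y i) ^ 2 := by field_simp
  linarith

/-- ★★ **(QEᴸ⁺) ∧ (RDᴸ) ∧ (DWᴸ)(`σ₀ < cE·D₀`, `0 ≤ cE`) ⟹ (OMᴸ)** — the exclusion form through the energetic sufficient route of ZZZR. [this file, g86] -/
theorem minInLabelTubeP_of_deficit {ϑc ϑ ϑp r rΘ q rsh ρ rm σ ϑr Rs ε rI ℓ Rg sb dI dB sb₁ dI₁ dB₁ Rd D₀ cE σ₀ aHi Λ θ s : ℝ} (hcE : 0 ≤ cE)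
    (hgap : σ₀ < cE * D₀) (hE : LabelTubeFillingP ϑc ϑ ϑp r rΘ q rsh ρ rm σ ϑr Rs ε rI ℓ Rg sb₁ dI₁ dB₁ aHi Λ θ s)
    (hRD : OffTubeDeficitFloorP ϑc ϑp r rΘ q rsh ρ rm σ ϑr Rs ε rI ℓ Rg sb dI dB sb₁ dI₁ dB₁ Rd D₀ aHi Λ θ s)
    (hDW : DeficitWellP ϑc ϑ ϑp r rΘ q rsh ρ rm σ ϑr Rs ε rI ℓ Rg sb₁ dI₁ dB₁ Rd cE σ₀ aHi Λ θ s) :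
    MinInLabelTubeP ϑc ϑp r rΘ q rsh ρ rm σ ϑr Rs ε rI ℓ Rg sb dI dB aHi Λ θ s :=
  minInLabelTubeP_of_gap (by linarith) hE (offTubeGapP_of_deficit hcE hRD hDW)

/-- ★★★ **THE W2″ DOOR (PROVED modulo its five hypotheses): `[MCMC](ϑc)` ⟸ (SC) ∧ (X1ᴸ)(lam > 0) ∧ (X2ᴸ)(radii) ∧ (RDᴸ)(Rd, D₀) ∧ (DWᴸ)(Rd, cE, σ₀)**
(`0 ≤ cE`, `σ₀ < cE·D₀`) at the record dials `(ϑp, r, rΘ, q, rsh, ρ, rm) = (1/10, 8, 145/16, 4, 12, 16, 16)`, shadow `(σ, ϑr, Rs, ε, rI, ℓ) = (17/20, 10⁻⁴, 5, 10⁻⁴,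
10, 43/2)`, `(aHi, Λ, θ, s) = (1, 2, 1/16, 1/50)`, door level `tameRadius`, outer radii in ZZZQ's (XRᴸ) polytope — the W2′ door of ZZZR with its residual
energetic hypothesis (OGᴸ) REPLACED by the kinematic floor and the rotation-covariant well. [this file, g86] -/
theorem mildCoolMoatCorePG_W2''_record {ϑc ϑ₀ Rg sb dI dB sb₁ dI₁ dB₁ lam Rd D₀ cE σ₀ : ℝ}
    (hlam : 0 < lam) (hcE : 0 ≤ cE) (hgap : σ₀ < cE * D₀) (hsb : sb₁ < sb) (hdI : dI₁ < dI) (hdB : dB₁ < dB) (hsb₀ : 0 ≤ sb₁) (hdI₀ : 0 ≤ dI₁)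
    (hdB₀ : 0 ≤ dB₁) (h2dB : 2 * dB < 17 / 20) (hRg : 4 + 2 * dB ≤ Rg) (hRs : 4 + 2 * dB + 1 / 10000 ≤ 5) (hfit : 16 + 1 / 10000 + Rg < 43 / 2)
    (hdIσ : dI + 1 / 10000 < 17 / 20) (hϑ₀ : (1 : ℝ) / 10000 + 1 / 10000 ≤ ϑ₀) (hϑ : ϑ₀ + max sb dI ≤ tameRadius)
    (hSC : CoolZoneShadowCrystalP ϑc (1 / 10) 8 4 12 16 (17 / 20) (1 / 10000) 5 (1 / 10000) 10 (43 / 2) 1 2 (1 / 16) (1 / 50))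
    (hX1 : LabelTubeConvexityP ϑc tameRadius (1 / 10) 8 (145 / 16) 4 12 16 16 (17 / 20) (1 / 10000) 5 (1 / 10000) 10 (43 / 2) ϑ₀ Rg sb dI dB
      lam 1 2 (1 / 16) (1 / 50))
    (hX2 : LabelLoadedTubeAprioriP ϑc tameRadius (1 / 10) 8 (145 / 16) 4 12 16 16 (17 / 20) (1 / 10000) 5 (1 / 10000) 10 (43 / 2) ϑ₀ Rg sb dI
      dB sb₁ dI₁ dB₁ 1 2 (1 / 16) (1 / 50))
    (hRD : OffTubeDeficitFloorP ϑc (1 / 10) 8 (145 / 16) 4 12 16 16 (17 / 20) (1 / 10000) 5 (1 / 10000) 10 (43 / 2) Rg sb dI dB sb₁ dI₁ dB₁ Rd D₀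
      1 2 (1 / 16) (1 / 50))
    (hDW : DeficitWellP ϑc tameRadius (1 / 10) 8 (145 / 16) 4 12 16 16 (17 / 20) (1 / 10000) 5 (1 / 10000) 10 (43 / 2) Rg sb₁ dI₁ dB₁ Rd cE σ₀
      1 2 (1 / 16) (1 / 50)) :
    MildCoolMoatCorePG ϑc tameRadius (1 / 10) 8 4 12 16 1 2 (1 / 16) (1 / 50) :=
  mildCoolMoatCorePG_W2'_record hlam (by linarith : 0 < cE * D₀ - σ₀) hsb hdI hdB hsb₀ hdI₀ hdB₀ h2dB hRg hRs hfit hdIσ hϑ₀ hϑ hSC hX1 hX2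
    (offTubeGapP_of_deficit hcE hRD hDW)

/-- ★★ **THE W2″ DOOR AT THE FATTEST CERTIFIED TUBE** `(Rg, sb, dI, dB) = (121/25, 249/5000, 249/5000, 21/50)`, `ϑ₀ = 1/5000`, deficit range `Rd := Rg = 121/25`:
`[MCMC](ϑc)` ⟸ (SC) ∧ (X1ᴸ)(lam > 0) ∧ (X2ᴸ) ∧ (RDᴸ)(D₀) ∧ (DWᴸ)(cE, σ₀) with a THIN INNER TUBE `0 ≤ sb₁, dI₁ ≤ sb/4 = 249/20000`, `0 ≤ dB₁ ≤ 2/5` (the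
rigid-motion budget `ω = sb₁ + Rg·φ* ≤ 0.0162 ≪ sb = 0.0498`; `0 ≤ cE`, `σ₀ < cE·D₀`; desk: `D₀ ≈ 2·N_Rg·(sb − ω)² ≈ 1.54`, `cE ≈ 5·10⁻⁴`, `σ₀ = 0`).
[this file, g86] -/
theorem mildCoolMoatCorePG_W2''_fat {ϑc sb₁ dI₁ dB₁ lam D₀ cE σ₀ : ℝ} (hlam : 0 < lam) (hcE : 0 ≤ cE) (hgap : σ₀ < cE * D₀)
    (hsb : 4 * sb₁ ≤ 249 / 5000) (hdI : 4 * dI₁ ≤ 249 / 5000) (hdB : dB₁ ≤ 2 / 5) (hsb₀ : 0 ≤ sb₁) (hdI₀ : 0 ≤ dI₁) (hdB₀ : 0 ≤ dB₁)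
    (hSC : CoolZoneShadowCrystalP ϑc (1 / 10) 8 4 12 16 (17 / 20) (1 / 10000) 5 (1 / 10000) 10 (43 / 2) 1 2 (1 / 16) (1 / 50))
    (hX1 : LabelTubeConvexityP ϑc tameRadius (1 / 10) 8 (145 / 16) 4 12 16 16 (17 / 20) (1 / 10000) 5 (1 / 10000) 10 (43 / 2) (1 / 5000) (121 / 25)
      (249 / 5000) (249 / 5000) (21 / 50) lam 1 2 (1 / 16) (1 / 50))
    (hX2 : LabelLoadedTubeAprioriP ϑc tameRadius (1 / 10) 8 (145 / 16) 4 12 16 16 (17 / 20) (1 / 10000) 5 (1 / 10000) 10 (43 / 2) (1 / 5000)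
      (121 / 25) (249 / 5000) (249 / 5000) (21 / 50) sb₁ dI₁ dB₁ 1 2 (1 / 16) (1 / 50))
    (hRD : OffTubeDeficitFloorP ϑc (1 / 10) 8 (145 / 16) 4 12 16 16 (17 / 20) (1 / 10000) 5 (1 / 10000) 10 (43 / 2) (121 / 25) (249 / 5000) (249 / 5000)
      (21 / 50) sb₁ dI₁ dB₁ (121 / 25) D₀ 1 2 (1 / 16) (1 / 50))
    (hDW : DeficitWellP ϑc tameRadius (1 / 10) 8 (145 / 16) 4 12 16 16 (17 / 20) (1 / 10000) 5 (1 / 10000) 10 (43 / 2) (121 / 25) sb₁ dI₁ dB₁ (121 / 25)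
      cE σ₀ 1 2 (1 / 16) (1 / 50)) :
    MildCoolMoatCorePG ϑc tameRadius (1 / 10) 8 4 12 16 1 2 (1 / 16) (1 / 50) :=
  mildCoolMoatCorePG_W2''_record hlam hcE hgap (by linarith) (by linarith) (by linarith) hsb₀ hdI₀ hdB₀ (by norm_num) (by norm_num) (by norm_num)
    (by norm_num) (by norm_num) (by norm_num) (by rw [max_self]; norm_num [tameRadius]) hSC hX1 hX2 hRD hDW

end Glue

end Summit.AtomisticToContinuum.Crystallization.Theorems.ChartedZeroExcessLayeredLatticeLiouville

end
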